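import Mathlib

/-!
# SoloBlindTwoPower — the structural lock T0(5), corollary (b′):
# a non-degenerate limit of discrete series on ANY host forces `[K : K_cm]` to be a power of two

Solo seat `solo-Langlands-blind`, session 12; sequel to `SoloBlindWeylDivisibility` (T0(5):
`m = [K : K_cm]` divides `|W(Δ_λ)|`, the Weyl group of the centraliser of the archimedean
infinitesimal character `λ_H` of any non-abelian functorial transfer of a regular algebraic
cuspidal `π` on `GL_n/K` to a host `H/ℚ` whose `*`-action is totally real or CM) and to
`SoloBlindNoncompactRoots` (if every root vanishing on `λ` is noncompact — Knapp–Zuckerman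
non-degeneracy of a limit of discrete series `π(λ, C)` — then `Δ_λ` is of type `A₁^k`, so
`W(Δ_λ) ≅ (ℤ/2)^k` has exponent `2`).

`SoloBlindWeylDivisibility` drew the consequence "no non-degenerate limit" only when `3 ∣ m`
(an element of order `3`).  The present file records the sharper and simpler reading:

THEOREM T0(5)(b′).  If some member of the archimedean packet of some transfer `ξ ∘ φ_{π,∞}` on some
real form of some admissible host is a NON-DEGENERATE limit of discrete series, then
`m = [K : K_cm]` is a power of `2`.  Equivalently: if `m` has an odd prime factor — every field
containing a complex cubic field (`SoloBlindCubicField`), every field of odd degree `> 1` over its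
maximal CM-or-totally-real subfield, e.g. quintic fields with a complex place (`m = 5`) — then no
transfer of `π` to any Shimura-type host is a non-degenerate limit of discrete series at infinity,
in addition to never being discrete series (T0(5)(a)).

Proof.  `m ∣ |W(Δ_λ)|` (T0(5), `structuralLock`) and `|W(A₁^k)| = 2^k`; a divisor of `2^k` is a
power of `2` (`eq_two_pow_of_dvd_card_of_sq_eq_one`).  The group-theoretic input "a finite group
of exponent `2` has order a power of `2`" is `card_eq_two_pow_of_sq_eq_one`; the passage from
commuting-involution generators to exponent `2` is
`SoloBlindWeylDivisibility.mul_self_eq_one_of_closure_commuting_involutions`, and the passage from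
non-degeneracy to commuting reflections is `SoloBlindNoncompactRoots.commute_reflection_of_noncompact`.
`structuralLock_two_pow` restates the conclusion over the lock hypotheses themselves (transitive
`Γ`-action on the live orbit `O` factoring through `q : Γ → A`, `A` a subquotient of `W`), with the
divisibility re-derived in three lines so that this file depends on Mathlib only.

What (b′) does NOT say (scope, as in T0(5)): for `m = 2^j` the Weyl-group count is silent.  `m = 2`
is the regime of Boxer–Calegari–Gee–Pilloni (`Δ_λ = A₁` on `GSp₄`, allowed and realised).  For
`m = 4` (a primitive totally imaginary quartic `K`, Galois group `S₄` or `A₄`; its cubic resolvent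
field `r` and the `S₃`-closure `R ⊇ r` are totally real, because complex conjugations are double
transpositions) the count CAN be met: over `r` one has `Gal(K^g/r) ≅ D₄` (`S₄` case) acting on the
four slots as the stabiliser of a pairing `{{x₁,x₂},{x₃,x₄}}`, and inside a form of `D₆` over `r`
split by `R/r`, with `SL₂^4 ↪ 4A₁ = {e₁∓e₂, e₃∓e₄} ⊂ D₄ ⊂ D₆` and parallel weight, `λ_H` has
vanishing `e₂`- and `e₄`-coordinates, `Δ_λ ⊇ {e₁−e₃, e₂−e₄, e₂+e₄}` can be arranged of type `A₁^k`,
and the slot action `D₄` is realised inside `Stab(λ_H)` by `⟨(13)(24), ε₂, ε₄⟩` (signed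
permutations; the odd ones through the outer automorphism, matching `Gal(R/r)`).  That line dies one
step later, at the real form: `{e₂ − e₄, e₂ + e₄} ⊆ Δ_λ` always contains a compact root of
`so*(12)`, and `so(10,2)` has real rank `2 < 3`; but the death is host-specific.  Hence
`m = 2^j ≥ 4` is decided host by host (seat notes HOME/ATTEMPTS.md A45, A48; not formalised), not by
this file.

[cite: KnappZuckerman1982, §1 (non-degenerate limits of discrete series)]
[cite: Goldring2016, p. 348, p. 357 (in Kerr–Pearlstein, LMS Lecture Notes 427)]
[cite: Clozel1990, Lemme 4.9] [cite: Patrikis2019, Prop. 2.4.7 (arXiv:1207.6724)]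
-/

namespace Summit.Langlands.Langlands.Theorems.SoloBlind

/-- A finite group in which every element squares to `1` has order a power of `2`. -/
theorem card_eq_two_pow_of_sq_eq_one {W : Type*} [Group W] [Finite W]
    (hW : ∀ w : W, w * w = 1) : ∃ k : ℕ, Nat.card W = 2 ^ k := by
  haveI : Fact (Nat.Prime 2) := ⟨Nat.prime_two⟩
  have hp : IsPGroup 2 W := fun g => ⟨1, by rw [pow_one, pow_two]; exact hW g⟩
  exact IsPGroup.iff_card.mp hp

/-- A divisor of the order of a finite group of exponent `2` is a power of `2`.  Reading:
`m = [K : K_cm] ∣ |W(Δ_λ)|` (T0(5)) and `Δ_λ = A₁^k` force `m = 2^j`. -/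
theorem eq_two_pow_of_dvd_card_of_sq_eq_one {W : Type*} [Group W] [Finite W] {m : ℕ}
    (hdvd : m ∣ Nat.card W) (hW : ∀ w : W, w * w = 1) : ∃ j : ℕ, m = 2 ^ j := by
  obtain ⟨k, hk⟩ := card_eq_two_pow_of_sq_eq_one hW
  rw [hk] at hdvd
  obtain ⟨j, -, hj⟩ := (Nat.dvd_prime_pow Nat.prime_two).mp hdvd
  exact ⟨j, hj⟩

/-- Contrapositive form used in the text: if an odd prime divides `m` and `m ∣ |W|`, then `W` is not
of exponent `2` — so `Δ_λ` is not of type `A₁^k` and no member of the packet is a non-degenerate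
limit of discrete series. -/
theorem exists_mul_self_ne_one_of_odd_prime_dvd {W : Type*} [Group W] [Finite W] {p m : ℕ}
    (hp : p.Prime) (hp2 : p ≠ 2) (hpm : p ∣ m) (hdvd : m ∣ Nat.card W) :
    ∃ w : W, w * w ≠ 1 := by
  by_contra h
  have h' : ∀ w : W, w * w = 1 := fun w => not_ne_iff.mp fun hw => h ⟨w, hw⟩
  obtain ⟨j, rfl⟩ := eq_two_pow_of_dvd_card_of_sq_eq_one hdvd h'
  exact hp2 ((Nat.prime_dvd_prime_iff_eq hp Nat.prime_two).mp (hp.dvd_of_dvd_pow hpm))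

/-- **T0(5)(b′) over the lock hypotheses.**  `Γ` (`= Gal(ℚ̄/M'')`) acts transitively on the live
orbit `O` of slots (`Nat.card O = m = [K : K_cm]`); the action factors through `q : Γ → A`
(an element centralising the torus `S = ξ(T̂_G)` moves no live slot); `A` is a subquotient of
`W = W(Δ_λ)` (`A ⊆ N_{L̂}(S)/C_{L̂}(S) ↪ Stab_W(S)/Fix_W(S)`); and `W` has exponent `2`
(`Δ_λ = A₁^k`, forced by Knapp–Zuckerman non-degeneracy).  Then `m` is a power of `2`. -/
theorem structuralLock_two_pow {Γ A W O : Type*} [Group Γ] [Group A] [Group W] [Finite W]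
    [MulAction Γ O] [MulAction.IsPretransitive Γ O] [Nonempty O] (q : Γ →* A)
    (hq : ∀ γ : Γ, q γ = 1 → ∀ x : O, γ • x = x)
    (N : Subgroup W) (f : N →* A) (hf : Function.Surjective f)
    (hW : ∀ w : W, w * w = 1) : ∃ j : ℕ, Nat.card O = 2 ^ j := by
  obtain ⟨x⟩ := ‹Nonempty O›
  -- m = [Γ : Stab x] ∣ [Γ : ker q] = |q(Γ)| ∣ |A| ∣ |N| ∣ |W|
  have hle : q.ker ≤ MulAction.stabilizer Γ x := fun γ hγ =>
    MulAction.mem_stabilizer_iff.mpr (hq γ (MonoidHom.mem_ker.mp hγ) x)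
  have h1 : Nat.card O ∣ Nat.card q.range := by
    rw [← MulAction.index_stabilizer_of_transitive Γ x, ← Subgroup.index_ker q]
    exact Subgroup.index_dvd_of_le hle
  have h2 : Nat.card q.range ∣ Nat.card A := Subgroup.card_subgroup_dvd_card q.range
  have h3 : Nat.card A ∣ Nat.card W :=
    (Subgroup.card_dvd_of_surjective f hf).trans (Subgroup.card_subgroup_dvd_card N)
  exact eq_two_pow_of_dvd_card_of_sq_eq_one ((h1.trans h2).trans h3) hW

/-- Sanity (`m = 3`, the `−23` cubic field): `S₃` acting on `Fin 3` with `A = W = S₃` satisfies the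
lock hypotheses, and `3` is not a power of `2`; so `W` cannot have exponent `2` — witnessed. -/
example : ∃ w : Equiv.Perm (Fin 3), w * w ≠ 1 :=
  exists_mul_self_ne_one_of_odd_prime_dvd (W := Equiv.Perm (Fin 3)) (m := 3) Nat.prime_three
    (by norm_num) (dvd_refl 3)
    (by rw [Nat.card_perm, Nat.card_eq_fintype_card, Fintype.card_fin]; decide)

/-- Sanity (`m = 4`): the Klein four-group (here `Multiplicative (ZMod 2 × ZMod 2)`) has exponent
`2` and order `4 = 2^2` — the count alone does not exclude `m = 4` (see the module docstring). -/
example : ∃ j : ℕ, (4 : ℕ) = 2 ^ j :=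
  eq_two_pow_of_dvd_card_of_sq_eq_one (W := Multiplicative (ZMod 2 × ZMod 2))
    (by simp [Nat.card_eq_fintype_card])
    (fun w => by
      have h : ∀ z : ZMod 2 × ZMod 2, z + z = 0 := by decide
      exact congrArg Multiplicative.ofAdd (h (Multiplicative.toAdd w)))

end Summit.Langlands.Langlands.Theorems.SoloBlind
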